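import Literature.Geometry.Riemannian.KarpukhinSternStabilization
import HarnessLib

/-!
# Karpukhin–Stern Lemma 3.6 from energy monotonicity, the energy gap and Euclidean volume growth
(sixth proof file of `KarpukhinSternHarmonicMaps.lean`; topic `Geometry/Riemannian`)

`KarpukhinSternAssembly.lean` proves the named fact
`Literature.Geometry.Riemannian.karpukhinStern_groundStateHarmonicMap` from KS Thm. 3.2 and KS
Lemma 3.6 (p. 750: "There exists `δ(M) > 0` such that for any nonconstant smooth harmonic map
`u : Mⁿ → Sᵏ` and any geodesic ball `B_δ(p) ⊂ M` of radius `δ`, `ind_E(u; M ∖ B_δ(p)) ⩾ k − 2`").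
Here Lemma 3.6 itself is PROVED, exactly as printed (p. 751), from its three inputs taken as
explicit hypotheses:

* (`hmono`) the energy monotonicity inequality "`∫_{B_{2δ}(p)} |du|² ⩽ C(M) δ^{n−2} ∫_M |du|²`"
  ("by the well-known energy-monotonicity properties of stationary harmonic maps"), for `δ ≤ δ₀`;
* (`hgap`) the energy gap `E(u) ⩾ β` of Prop. 5.5 (appendix) for nonconstant harmonic maps
  `u : M → Sᵏ`, `β` independent of `k`;
* (`hvol`) Euclidean volume growth of small geodesic balls, `Vol B(p, s) ≤ C_v sᵐ` for `s ≤ s₀`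
  (elementary; the matching lower bound is `VolumeSmallBalls.lean`).

`karpukhinStern_lemma36_of_monotonicity_of_gap`: if `ind_E(u; N ∖ B_δ(p)) ≤ k − 3` then Lemma 3.3
(`karpukhinStern_lemma33_on`, `p = 1`) gives `∫ ψ²|du|² ≤ 4 ∫|dψ|²` for the complementary cut-off
`ψ = 1 − χ` (`χ` from `exists_metric_cutoff` on `B(p, 4δ)`: `ψ = 0` on `B_{2δ}`, `ψ = 1` off
`B_{4δ}`, `|dψ|² ≤ C₀/(4δ)²`), so `∫_{N∖B_{4δ}} |du|² ≤ 4 C₀ C_v (4δ)^{m−2}` ((3.5)–(3.6)); with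
`∫_{B_{4δ}}|du|² ≤ C₁(2δ)^{m−2}∫|du|² ≤ ½∫|du|²` ((3.7)) and `∫|du|² ≥ β` this is impossible once
`δ` is small (`m ≥ 3`). Everything is proved; no definitions, no named facts.

## References

* M. Karpukhin, D. Stern, *Existence of harmonic maps and eigenvalue optimization in higher
  dimensions*, Invent. Math. 236 (2024) 713–778, Lemma 3.6 and its proof, pp. 750–751;
  Prop. 5.5 (p. 773). [KarpukhinStern2024]
-/

noncomputable section

open Module Finset Filter
open scoped InnerProductSpace BigOperators Manifold ContDiff Topology ENNReal NNReal

namespace Literature.Geometry.Riemannian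

namespace KarpukhinStern

section Lemma36

open Lorentzian Lorentzian.PseudoRiemannianMetric Bundle
open _root_.MeasureTheory

variable {m : ℕ} {H' : Type*} [TopologicalSpace H']
  {J : ModelWithCorners ℝ (EuclideanSpace ℝ (Fin m)) H'} [J.Boundaryless]
  {N : Type*} [TopologicalSpace N] [ChartedSpace H' N] [IsManifold J ∞ N] [CompactSpace N]
  [T2Space N] [T3Space N] [SecondCountableTopology N] [MeasurableSpace N] [BorelSpace N]
  (h : ContMDiffRiemannianMetric J ∞ (EuclideanSpace ℝ (Fin m)) (TangentSpace J : N → Type _))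
  [(ofRiemannian h).HasLeviCivita]

set_option maxHeartbeats 800000 in
/-- **Karpukhin–Stern, Lemma 3.6, from energy monotonicity, the energy gap and Euclidean volume
growth** (p. 750–751). On a closed Riemannian manifold of dimension `m ≥ 3` assume:
(`hvol`) small geodesic balls have volume `≤ C_v sᵐ`; (`hmono`) the energy monotonicity
inequality "`∫_{B_{2δ}(p)} |du|² ⩽ C(M) δ^{n−2} ∫_M |du|²`" for nonconstant smooth harmonic maps
`u : N → Sᵏ` and `δ ≤ δ₀` (p. 751, "the well-known energy-monotonicity properties of stationary
harmonic maps"); (`hgap`) the energy gap `∫_M |du|² ≥ β > 0` of Prop. 5.5. Then there is `δ > 0`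
with `ind_E(u; N ∖ B_δ(p)) ≥ k − 2` for every nonconstant smooth harmonic `u : N → Sᵏ` and every
`p`. Proof as printed: otherwise `ind_E(u; N ∖ B_δ) ≤ k − 3` and Lemma 3.3
(`karpukhinStern_lemma33_on`) gives `∫ ψ²|du|² ≤ 4∫|dψ|²` for `ψ = 1 − χ`, `χ` the cut-off of
`exists_metric_cutoff` on `B(p, 4δ)` (`ψ = 0` on `B_{2δ}`, `= 1` off `B_{4δ}`, `|dψ|² ≤ C₀/(4δ)²`);
hence `∫_{N∖B_{4δ}}|du|² ≤ C δ^{m−2}` ((3.6)), while monotonicity gives `∫_{B_{4δ}}|du|² ≤ ½∫|du|²`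
for small `δ` ((3.7)), contradicting the gap. [cite: KarpukhinStern2024, Lemma 3.6 pp. 750–751] -/
theorem karpukhinStern_lemma36_of_monotonicity_of_gap (hm3 : 3 ≤ m)
    {Cv s₀ : ℝ} (hs₀ : 0 < s₀)
    (hvol : ∀ (p : N) (s : ℝ), 0 < s → s ≤ s₀ →
      (riemannianMeasure h ((ofRiemannian h).ball p (ENNReal.ofReal s))).toReal ≤ Cv * s ^ m)
    {C₁ δ₀ : ℝ} (hδ₀ : 0 < δ₀)
    (hmono : ∀ {k : ℕ} (u : N → Metric.sphere (0 : EuclideanSpace ℝ (Fin (k + 1))) 1)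
      (_hu : ContMDiff J (𝓡 k) ∞ u),
      (∀ (i : Fin (k + 1)) (x : N), (ofRiemannian h).dalembertian
        (fun y ↦ (u y : EuclideanSpace ℝ (Fin (k + 1))) i) x =
          -(energyDensity h u x) * (u x : EuclideanSpace ℝ (Fin (k + 1))) i) →
      (∃ x y : N, u x ≠ u y) → ∀ (p : N) (δ : ℝ), 0 < δ → δ ≤ δ₀ →
      ∫ x in (ofRiemannian h).ball p (ENNReal.ofReal (2 * δ)), energyDensity h u x ∂riemannianMeasure h ≤
        C₁ * δ ^ (m - 2) * ∫ x, energyDensity h u x ∂riemannianMeasure h)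
    {β : ℝ} (hβ : 0 < β)
    (hgap : ∀ {k : ℕ} (u : N → Metric.sphere (0 : EuclideanSpace ℝ (Fin (k + 1))) 1)
      (_hu : ContMDiff J (𝓡 k) ∞ u),
      (∀ (i : Fin (k + 1)) (x : N), (ofRiemannian h).dalembertian
        (fun y ↦ (u y : EuclideanSpace ℝ (Fin (k + 1))) i) x =
          -(energyDensity h u x) * (u x : EuclideanSpace ℝ (Fin (k + 1))) i) →
      (∃ x y : N, u x ≠ u y) → β ≤ ∫ x, energyDensity h u x ∂riemannianMeasure h) :
    ∃ δ : ℝ, 0 < δ ∧ ∀ {k : ℕ} (u : N → Metric.sphere (0 : EuclideanSpace ℝ (Fin (k + 1))) 1)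
      (hu : ContMDiff J (𝓡 k) ∞ u),
      (∀ (i : Fin (k + 1)) (x : N), (ofRiemannian h).dalembertian
        (fun y ↦ (u y : EuclideanSpace ℝ (Fin (k + 1))) i) x =
          -(energyDensity h u x) * (u x : EuclideanSpace ℝ (Fin (k + 1))) i) →
      (∃ x y : N, u x ≠ u y) →
      ∀ p : N, ((k - 2 : ℕ) : ℕ∞) ≤ energyIndexOn h hu ((ofRiemannian h).ball p (ENNReal.ofReal δ))ᶜ := by
  classical
  set g := ofRiemannian h with hg
  set μ := riemannianMeasure h with hμ
  have hgR : g.IsRiemannian := isRiemannian_ofRiemannian h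
  haveI := isFiniteMeasure_riemannianMeasure h
  obtain ⟨C₀, hC₀⟩ := exists_metric_cutoff.{_, _, _}
  -- the constants
  set A : ℝ := max C₁ 0 with hA
  set C₀' : ℝ := max C₀ 0 with hC₀'
  set Cv' : ℝ := max Cv 0 with hCv'
  set Bc : ℝ := 4 * C₀' * Cv' with hBc
  have hA0 : 0 ≤ A := le_max_right _ _
  have hC₀'0 : 0 ≤ C₀' := le_max_right _ _
  have hCv'0 : 0 ≤ Cv' := le_max_right _ _
  have hBc0 : 0 ≤ Bc := by positivity
  set δ : ℝ := min (min (δ₀ / 2) (s₀ / 4)) (min (1 / 4) (min (1 / (4 * (A + 1))) (β / (16 * (Bc + 1))))) with hδdef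
  have hδpos : 0 < δ := by
    simp only [hδdef, lt_min_iff]
    refine ⟨⟨by linarith, by linarith⟩, by norm_num, by positivity, by positivity⟩
  have hδ1 : δ ≤ δ₀ / 2 := (min_le_left _ _).trans (min_le_left _ _)
  have hδ2 : δ ≤ s₀ / 4 := (min_le_left _ _).trans (min_le_right _ _)
  have hδ3 : δ ≤ 1 / 4 := (min_le_right _ _).trans (min_le_left _ _)
  have hδ4 : δ ≤ 1 / (4 * (A + 1)) := ((min_le_right _ _).trans (min_le_right _ _)).trans (min_le_left _ _)
  have hδ5 : δ ≤ β / (16 * (Bc + 1)) := ((min_le_right _ _).trans (min_le_right _ _)).trans (min_le_right _ _)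
  -- `(cδ)^{m-2} ≤ cδ` for `cδ ≤ 1`
  have hpow : ∀ t : ℝ, 0 ≤ t → t ≤ 1 → t ^ (m - 2) ≤ t := fun t ht0 ht1 ↦ by
    have : m - 2 = (m - 3) + 1 := by omega
    rw [this, pow_succ]
    exact mul_le_of_le_one_left ht0 (pow_le_one₀ ht0 ht1)
  -- (3): `A (2δ)^{m-2} ≤ 1/2`
  have h3 : A * (2 * δ) ^ (m - 2) ≤ 1 / 2 := by
    have h1 : (2 * δ) ^ (m - 2) ≤ 2 * δ := hpow _ (by linarith) (by linarith)
    have h2 : A * (2 * δ) ≤ 1 / 2 := by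
      have : δ * (4 * (A + 1)) ≤ 1 := by
        rw [le_div_iff₀ (by positivity)] at hδ4; linarith
      nlinarith
    exact (mul_le_mul_of_nonneg_left h1 hA0).trans h2
  -- (4): `Bc (4δ)^{m-2} < β/2`
  have h4 : Bc * (4 * δ) ^ (m - 2) < β / 2 := by
    have h1 : (4 * δ) ^ (m - 2) ≤ 4 * δ := hpow _ (by linarith) (by linarith)
    have h2 : Bc * (4 * δ) < β / 2 := by
      have : δ * (16 * (Bc + 1)) ≤ β := by
        rw [le_div_iff₀ (by positivity)] at hδ5; linarith
      nlinarith
    exact lt_of_le_of_lt (mul_le_mul_of_nonneg_left h1 hBc0) h2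
  refine ⟨δ, hδpos, fun {k} u hu harm hne p ↦ ?_⟩
  by_contra hind
  push Not at hind
  -- `k ≥ 3` and `ind ≤ k - 3`
  have hk3 : 3 ≤ k := by
    by_contra hk
    push Not at hk
    have : k - 2 = 0 := by omega
    rw [this] at hind
    exact absurd hind (not_lt.2 bot_le)
  have hind' : energyIndexOn h hu (g.ball p (ENNReal.ofReal δ))ᶜ ≤ ((k - 3 : ℕ) : ℕ∞) := by
    have : ((k - 2 : ℕ) : ℕ∞) = ((k - 3 : ℕ) : ℕ∞) + 1 := by
      rw [← ENat.coe_one, ← ENat.coe_add]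
      congr 1
      omega
    rw [this] at hind
    exact (ENat.lt_add_one_iff (ENat.coe_ne_top _)).1 hind
  -- the cut-off on `B(p, 4δ)` and `ψ = 1 − χ`
  obtain ⟨χ, hχs, hχ0, hχ1, hχone, hχsupp, hχgrad⟩ := hC₀ J N g hgR p (4 * δ) (by linarith)
  set ψ : N → ℝ := fun x ↦ 1 - χ x with hψdef
  have hψs : ContMDiff J 𝓘(ℝ, ℝ) ∞ ψ := contMDiff_const.sub hχs
  have hψzero : ∀ x ∈ g.ball p (ENNReal.ofReal (2 * δ)), ψ x = 0 := by
    intro x hx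
    have : χ x = 1 := hχone x (by
      have : ENNReal.ofReal (4 * δ / 2) = ENNReal.ofReal (2 * δ) := by congr 1; ring
      rwa [this])
    simp [hψdef, this]
  have hballopen : ∀ r : ℝ≥0∞, IsOpen (g.ball p r) := fun r ↦ PseudoRiemannianMetric.isOpen_ball hgR p r
  have hψsupp : tsupport ψ ⊆ (g.ball p (ENNReal.ofReal δ))ᶜ := by
    have h1 : Function.support ψ ⊆ (g.ball p (ENNReal.ofReal (2 * δ)))ᶜ := by
      intro x hx hxball
      exact hx (hψzero x hxball)
    have h2 : tsupport ψ ⊆ (g.ball p (ENNReal.ofReal (2 * δ)))ᶜ :=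
      closure_minimal h1 (hballopen _).isClosed_compl
    refine h2.trans (Set.compl_subset_compl.2 (g.ball_mono p (ENNReal.ofReal_le_ofReal (by linarith))))
  -- Lemma 3.3
  have hMk : (k - 3) + 2 < k := by omega
  have h33 := karpukhinStern_lemma33_on h hu harm hψs hψsupp hind' hMk
  have hcast : ((k - 3 : ℕ) : ℝ) = (k : ℝ) - 3 := by
    rw [Nat.cast_sub hk3]; norm_num
  rw [hcast] at h33
  have h33' : ∫ x, ψ x ^ 2 * energyDensity h u x ∂μ ≤
      4 * ∫ x, g.innerDual x (mvfderiv J ψ x).toLinearMap (mvfderiv J ψ x).toLinearMap ∂μ := by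
    have e1 : ((k : ℝ) - 2 - ((k : ℝ) - 3)) = 1 := by ring
    have e2 : ((k : ℝ) - ((k : ℝ) - 3) + 1) = 4 := by ring
    rw [e1, e2, one_mul] at h33
    exact h33
  -- the energy
  set e := energyDensity h u with hedef
  have hec : Continuous e := continuous_energyDensity h hu
  have he0 : ∀ x, 0 ≤ e x := fun x ↦ energyDensity_nonneg' h u x
  have hIe : Integrable e μ := integrable_of_continuous h hec
  -- (α) `∫ ψ² e ≥ ∫ e − ∫_{B(4δ)} e`
  have hχzero : ∀ x ∉ g.ball p (ENNReal.ofReal (4 * δ)), χ x = 0 := fun x hx ↦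
    image_eq_zero_of_notMem_tsupport fun h' ↦ hx (hχsupp h')
  have hα : ∫ x, e x ∂μ - ∫ x in g.ball p (ENNReal.ofReal (4 * δ)), e x ∂μ ≤
      ∫ x, ψ x ^ 2 * e x ∂μ := by
    have hpt : ∀ x, e x - (g.ball p (ENNReal.ofReal (4 * δ))).indicator e x ≤ ψ x ^ 2 * e x := by
      intro x
      by_cases hx : x ∈ g.ball p (ENNReal.ofReal (4 * δ))
      · rw [Set.indicator_of_mem hx]
        have : 0 ≤ ψ x ^ 2 * e x := mul_nonneg (sq_nonneg _) (he0 x)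
        linarith
      · rw [Set.indicator_of_notMem hx]
        simp [hψdef, hχzero x hx]
    have hIind : Integrable ((g.ball p (ENNReal.ofReal (4 * δ))).indicator e) μ :=
      hIe.indicator (hballopen _).measurableSet
    have hIψ : Integrable (fun x ↦ ψ x ^ 2 * e x) μ :=
      integrable_of_continuous h ((hψs.continuous.pow 2).mul hec)
    have hIdiff : Integrable (fun x ↦ e x - (g.ball p (ENNReal.ofReal (4 * δ))).indicator e x) μ :=
      hIe.sub hIind
    have h1 := integral_mono hIdiff hIψ hpt
    rw [integral_sub hIe hIind, integral_indicator (hballopen _).measurableSet] at h1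
    exact h1
  -- (β) monotonicity: `∫_{B(4δ)} e ≤ ½ ∫ e`
  have hβ' : ∫ x in g.ball p (ENNReal.ofReal (4 * δ)), e x ∂μ ≤ 1 / 2 * ∫ x, e x ∂μ := by
    have h1 := hmono u hu harm hne p (2 * δ) (by linarith) (by linarith)
    have h2 : ENNReal.ofReal (2 * (2 * δ)) = ENNReal.ofReal (4 * δ) := by congr 1; ring
    rw [h2] at h1
    have hI0 : 0 ≤ ∫ x, e x ∂μ := integral_nonneg he0
    have h5 : C₁ * (2 * δ) ^ (m - 2) ≤ 1 / 2 :=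
      (mul_le_mul_of_nonneg_right (le_max_left C₁ 0) (pow_nonneg (by linarith) _)).trans h3
    calc ∫ x in g.ball p (ENNReal.ofReal (4 * δ)), e x ∂μ ≤ C₁ * (2 * δ) ^ (m - 2) * ∫ x, e x ∂μ := h1
      _ ≤ 1 / 2 * ∫ x, e x ∂μ := mul_le_mul_of_nonneg_right h5 hI0
  -- (γ) `∫ |dψ|² ≤ C₀' Cv' (4δ)^{m-2}`
  have hγ : ∫ x, g.innerDual x (mvfderiv J ψ x).toLinearMap (mvfderiv J ψ x).toLinearMap ∂μ ≤
      C₀' * Cv' * (4 * δ) ^ (m - 2) := by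
    -- pointwise `|dψ|² = |dχ|² ≤ (C₀'/(4δ)²) 1_{B(4δ)}`
    have hχd : ∀ x, MDifferentiableAt J 𝓘(ℝ, ℝ) χ x := fun x ↦ hχs.mdifferentiableAt (by simp)
    have hd : ∀ x, mvfderiv J ψ x = -mvfderiv J χ x := by
      intro x
      change mvfderiv J (fun y ↦ (1 : ℝ) - χ y) x = _
      rw [mvfderiv_fun_sub (mdifferentiableAt_const ..) (hχd x), mvfderiv_const, zero_sub]
    have hgradψ : ∀ x, g.innerDual x (mvfderiv J ψ x).toLinearMap (mvfderiv J ψ x).toLinearMap =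
        g.gradSq χ x := by
      intro x
      rw [hd x]
      simp only [ContinuousLinearMap.toLinearMap_neg, PseudoRiemannianMetric.innerDual, map_neg,
        LinearMap.neg_apply, neg_neg]
      rfl
    have hpt : ∀ x, g.innerDual x (mvfderiv J ψ x).toLinearMap (mvfderiv J ψ x).toLinearMap ≤
        (g.ball p (ENNReal.ofReal (4 * δ))).indicator (fun _ ↦ C₀' / (4 * δ) ^ 2) x := by
      intro x
      rw [hgradψ x]
      by_cases hx : x ∈ g.ball p (ENNReal.ofReal (4 * δ))
      · rw [Set.indicator_of_mem hx]
        exact (hχgrad x).trans (div_le_div_of_nonneg_right (le_max_left _ _) (by positivity))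
      · rw [Set.indicator_of_notMem hx]
        have hx' : x ∉ tsupport χ := fun h' ↦ hx (hχsupp h')
        simp [PseudoRiemannianMetric.gradSq, mvfderiv_eq_zero_of_notMem_tsupport hx',
          PseudoRiemannianMetric.innerDual]
    have hIgrad : Integrable (fun x ↦ g.innerDual x (mvfderiv J ψ x).toLinearMap
        (mvfderiv J ψ x).toLinearMap) μ :=
      integrable_of_continuous h (continuous_innerDual_mvfderiv g (hψs.of_le (by exact_mod_cast le_top))
        (hψs.of_le (by exact_mod_cast le_top)))
    have hIind : Integrable ((g.ball p (ENNReal.ofReal (4 * δ))).indicator fun _ ↦ C₀' / (4 * δ) ^ 2) μ :=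
      (integrable_const _).indicator (hballopen _).measurableSet
    have h1 := integral_mono hIgrad hIind hpt
    rw [integral_indicator_const _ (hballopen _).measurableSet, smul_eq_mul] at h1
    refine h1.trans ?_
    have hv := hvol p (4 * δ) (by linarith) (by linarith)
    have hμ0 : 0 ≤ (μ (g.ball p (ENNReal.ofReal (4 * δ)))).toReal := ENNReal.toReal_nonneg
    have hm2 : m = (m - 2) + 2 := by omega
    calc (μ (g.ball p (ENNReal.ofReal (4 * δ)))).toReal * (C₀' / (4 * δ) ^ 2)
        ≤ (Cv' * (4 * δ) ^ m) * (C₀' / (4 * δ) ^ 2) := by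
          refine mul_le_mul_of_nonneg_right (hv.trans ?_) (by positivity)
          exact mul_le_mul_of_nonneg_right (le_max_left _ _) (pow_nonneg (by linarith) _)
      _ = C₀' * Cv' * (4 * δ) ^ (m - 2) := by
          conv_lhs => rw [hm2, pow_add]
          have : (4 * δ) ^ 2 ≠ 0 := by positivity
          field_simp
  -- contradiction with the gap
  have hgap' := hgap u hu harm hne
  have hfin : β / 2 ≤ 4 * (C₀' * Cv' * (4 * δ) ^ (m - 2)) := by
    have h1 : 1 / 2 * ∫ x, e x ∂μ ≤ ∫ x, ψ x ^ 2 * e x ∂μ := by linarith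
    have h2 : ∫ x, ψ x ^ 2 * e x ∂μ ≤ 4 * (C₀' * Cv' * (4 * δ) ^ (m - 2)) :=
      h33'.trans (mul_le_mul_of_nonneg_left hγ (by norm_num))
    change β ≤ ∫ x, e x ∂μ at hgap'
    linarith
  have : 4 * (C₀' * Cv' * (4 * δ) ^ (m - 2)) = Bc * (4 * δ) ^ (m - 2) := by rw [hBc]; ring
  rw [this] at hfin
  linarith

end Lemma36

end KarpukhinStern

end Literature.Geometry.Riemannian
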